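import Summits.CriticalPhenomena.PercolationContinuityZ3.Theorems.PercNearOneGluingNoHeavyLowerTailSunflowerPurePayer
import HarnessLib

/-!
# `NoHeavyLowerTail` (crux stmt-CriticalPhenomena-4575), abstract sunflower cubic: the partition lemma and its two halves as
# "TWO BLOCKS IN THE CORE versus ONE BLOCK IN EACH UP-SET" counting inequalities

Support file (seat `prim-ineq-prove-1` gen 29; `--supports stmt-CriticalPhenomena-4575`).  Nothing is asserted about the crux; no `sorry`.
Memo: run/shared/lean/prim/prim-ineq-prove-1/FINDING-PAYER-prove1-g29.md §5.

For a sunflower of up-sets `F` (`V 0, V 1, V 2` with all pairwise intersections `= A`; petals `C_i = V i ∖ A`, bottom `B`) count ordered 3-partitions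
`(P¹,P²,P³)` of the ground set:
* `NAA` = number with `P¹, P² ∈ A` (third block arbitrary);   `NV` = number with `P¹ ∈ V 0, P² ∈ V 1, P³ ∈ V 2`;
* `NBB` = number with `P¹, P² ∈ B`;                              `ND` = number with `Pⁱ ∈ B ∪ C_i` for `i = 1,2,3` (`B ∪ C_i = (V_j ∪ V_k)ᶜ`, the dual down-sets);
* `N123` = number of rainbows in the fixed order (`Pⁱ ∈ C_i`), so `Ntri = 6·N123`.
THEOREMS (exact identities, this work):  `3·SA − Ntri = 6·(NAA − NV)`,  `3·SB − Ntri = 6·(NBB − ND)`,  hence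
  `ZH = 6·(NAA + NBB + N123 − NV − ND)`,
  Lemma A (`Ntri ≤ 3·SA`) `⟺ NV ≤ NAA`,  Lemma B `⟺ ND ≤ NBB`,  `PurePayer ⟺ ∀F, NV ≤ NAA ∨ ND ≤ NBB`,
  `PartitionLemmaH ⟺ ∀F, NV + ND ≤ NAA + NBB + N123`.
Law-level shadows (three i.i.d. samples): Lemma A `⟺ μ(V₁)μ(V₂)μ(V₃) ≤ μ(A)²`, i.e. `a·(ab − e₂(c)) − e₃(c) = a² − Π(a + c_i)`; the `H`-row
`(a+b)(ab − e₂) − e₃ ≥ 0 ⟺ Πμ(V_i) + Πμ(B ∪ C_i) ≤ μ(A)² + μ(B)² + Πμ(C_i)`.  On star-type compositions `NV = NAA` exactly (memo §2, §5.3: a block-sorting bijection),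
on product-type compositions `ND = NBB`.
-/

namespace Summit.CriticalPhenomena.PercolationContinuityZ3.Theorems.SunflowerPartition

open Finset

variable {α : Type*} [Fintype α] [DecidableEq α]

/-! ## Pointwise indicators on `M₃ = Fin 5` (`0` bottom, `1,2,3` petals, `4` top) -/

/-- `[x = ⊤ ∧ y = ⊤]`. [this work] -/
def pairA (x y : Fin 5) : ℤ := if x = 4 ∧ y = 4 then 1 else 0

/-- `[x = 0 ∧ y = 0]`. [this work] -/
def pairB (x y : Fin 5) : ℤ := if x = 0 ∧ y = 0 then 1 else 0

/-- `[x ∈ V₁][y ∈ V₂][z ∈ V₃]` in label form (`V_i` = label `i` or `⊤`). [this work] -/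
def vind (x y z : Fin 5) : ℤ := if (x = 1 ∨ x = 4) ∧ (y = 2 ∨ y = 4) ∧ (z = 3 ∨ z = 4) then 1 else 0

/-- `[x ∈ B ∪ C₁][y ∈ B ∪ C₂][z ∈ B ∪ C₃]` in label form. [this work] -/
def dind (x y z : Fin 5) : ℤ := if (x = 1 ∨ x = 0) ∧ (y = 2 ∨ y = 0) ∧ (z = 3 ∨ z = 0) then 1 else 0

/-- `[(x,y,z) = (1,2,3)]` (rainbow in the fixed order). [this work] -/
def rind (x y z : Fin 5) : ℤ := if x = 1 ∧ y = 2 ∧ z = 3 then 1 else 0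

/-- Pointwise identity behind `3·SA − Ntri = 6(NAA − NV)` (symmetrised over the six block orders). [this work] -/
theorem specA_pointwise : ∀ x y z : Fin 5,
    ((if x = 4 then (1 : ℤ) else 0) * kk y z + (if y = 4 then (1 : ℤ) else 0) * kk x z + (if z = 4 then (1 : ℤ) else 0) * kk x y)
      - triP x y z
    = 2 * (pairA x y + pairA x z + pairA y z)
      - (vind x y z + vind x z y + vind y x z + vind y z x + vind z x y + vind z y x) := by
  decide

/-- Pointwise identity behind `3·SB − Ntri = 6(NBB − ND)`. [this work] -/
theorem specB_pointwise : ∀ x y z : Fin 5,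
    ((if x = 0 then (1 : ℤ) else 0) * kk y z + (if y = 0 then (1 : ℤ) else 0) * kk x z + (if z = 0 then (1 : ℤ) else 0) * kk x y)
      - triP x y z
    = 2 * (pairB x y + pairB x z + pairB y z)
      - (dind x y z + dind x z y + dind y x z + dind y z x + dind z x y + dind z y x) := by
  decide

/-- `triP` = rainbow indicator symmetrised. [this work] -/
theorem triP_eq_rind : ∀ x y z : Fin 5,
    triP x y z = rind x y z + rind x z y + rind y x z + rind y z x + rind z x y + rind z y x := by
  decide

/-! ## Block permutations of sums over ordered 3-partitions (from `sum_parts_swap12/13`) -/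

/-- Swapping the second and third blocks. [this work] -/
theorem sum_parts_swap23 (f : Finset α → Finset α → Finset α → ℤ) :
    ∑ q ∈ parts α, f q.1 q.2 (q.1 ∪ q.2)ᶜ = ∑ q ∈ parts α, f q.1 (q.1 ∪ q.2)ᶜ q.2 := by
  have h1 := sum_parts_swap13 (α := α) f
  have h2 := sum_parts_swap12 (α := α) (fun a b c => f c b a)
  have h3 := sum_parts_swap13 (α := α) (fun a b c => f c a b)
  exact h1.trans (h2.trans h3)

/-- Cyclic shift of the arguments: `f(P¹,P²,P³) ↦ f(P³,P¹,P²)`. [this work] -/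
theorem sum_parts_cyc (f : Finset α → Finset α → Finset α → ℤ) :
    ∑ q ∈ parts α, f q.1 q.2 (q.1 ∪ q.2)ᶜ = ∑ q ∈ parts α, f (q.1 ∪ q.2)ᶜ q.1 q.2 := by
  have h1 := sum_parts_swap12 (α := α) f
  have h2 := sum_parts_swap23 (α := α) (fun a b c => f b a c)
  exact h1.trans h2

/-- Cyclic shift of the arguments: `f(P¹,P²,P³) ↦ f(P²,P³,P¹)`. [this work] -/
theorem sum_parts_cyc' (f : Finset α → Finset α → Finset α → ℤ) :
    ∑ q ∈ parts α, f q.1 q.2 (q.1 ∪ q.2)ᶜ = ∑ q ∈ parts α, f q.2 (q.1 ∪ q.2)ᶜ q.1 := by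
  have h1 := sum_parts_swap13 (α := α) f
  have h2 := sum_parts_swap23 (α := α) (fun a b c => f c b a)
  exact h1.trans h2

/-- A sum over ordered 3-partitions of a function of the three labels equals one sixth of the sum of its six block-permutations. [this work] -/
theorem sum_parts_symm6 (g : Fin 5 → Fin 5 → Fin 5 → ℤ) (F : Sunflower α) :
    6 * ∑ q ∈ parts α, g (F.lab q.1) (F.lab q.2) (F.lab (q.1 ∪ q.2)ᶜ)
      = ∑ q ∈ parts α, (g (F.lab q.1) (F.lab q.2) (F.lab (q.1 ∪ q.2)ᶜ) + g (F.lab q.1) (F.lab (q.1 ∪ q.2)ᶜ) (F.lab q.2)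
          + g (F.lab q.2) (F.lab q.1) (F.lab (q.1 ∪ q.2)ᶜ) + g (F.lab q.2) (F.lab (q.1 ∪ q.2)ᶜ) (F.lab q.1)
          + g (F.lab (q.1 ∪ q.2)ᶜ) (F.lab q.1) (F.lab q.2) + g (F.lab (q.1 ∪ q.2)ᶜ) (F.lab q.2) (F.lab q.1)) := by
  have e2 := sum_parts_swap23 (α := α) (fun a b c => g (F.lab a) (F.lab b) (F.lab c))
  have e3 := sum_parts_swap12 (α := α) (fun a b c => g (F.lab a) (F.lab b) (F.lab c))
  have e4 := sum_parts_cyc (α := α) (fun a b c => g (F.lab a) (F.lab b) (F.lab c))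
  have e5 := sum_parts_cyc' (α := α) (fun a b c => g (F.lab a) (F.lab b) (F.lab c))
  have e6 := sum_parts_swap13 (α := α) (fun a b c => g (F.lab a) (F.lab b) (F.lab c))
  rw [sum_add_distrib, sum_add_distrib, sum_add_distrib, sum_add_distrib, sum_add_distrib, ← e2, ← e3, ← e4, ← e5, ← e6]
  ring

namespace Sunflower

variable (F : Sunflower α)

/-- `NAA` = number of ordered 3-partitions whose first two blocks lie in the core `A`. [this work] -/
def NAA : ℤ := ∑ q ∈ parts α, pairA (F.lab q.1) (F.lab q.2)

/-- `NBB` = number of ordered 3-partitions whose first two blocks lie in the bottom `B`. [this work] -/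
def NBB : ℤ := ∑ q ∈ parts α, pairB (F.lab q.1) (F.lab q.2)

/-- `NV` = number of ordered 3-partitions with `Pⁱ ∈ V_i = A ∪ C_i` for `i = 1,2,3`. [this work] -/
def NV : ℤ := ∑ q ∈ parts α, vind (F.lab q.1) (F.lab q.2) (F.lab (q.1 ∪ q.2)ᶜ)

/-- `ND` = number of ordered 3-partitions with `Pⁱ ∈ B ∪ C_i` for `i = 1,2,3`. [this work] -/
def ND : ℤ := ∑ q ∈ parts α, dind (F.lab q.1) (F.lab q.2) (F.lab (q.1 ∪ q.2)ᶜ)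

/-- `N123` = number of rainbow ordered 3-partitions in the fixed order `Pⁱ ∈ C_i`. [this work] -/
def N123 : ℤ := ∑ q ∈ parts α, rind (F.lab q.1) (F.lab q.2) (F.lab (q.1 ∪ q.2)ᶜ)

/-- `Ntri = 6·N123`. [this work] -/
theorem Ntri_eq_six_mul_N123 : F.Ntri = 6 * F.N123 := by
  unfold Ntri N123
  rw [sum_parts_symm6 rind F]
  exact sum_congr rfl fun q _ => triP_eq_rind _ _ _

/-- `6·NAA` symmetrised: twice the number of (partition, pair of core blocks). [this work] -/
theorem six_NAA_eq : 6 * F.NAA = ∑ q ∈ parts α,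
    2 * (pairA (F.lab q.1) (F.lab q.2) + pairA (F.lab q.1) (F.lab (q.1 ∪ q.2)ᶜ) + pairA (F.lab q.2) (F.lab (q.1 ∪ q.2)ᶜ)) := by
  unfold NAA
  rw [sum_parts_symm6 (fun x y _ => pairA x y) F]
  refine sum_congr rfl fun q _ => ?_
  have hs : ∀ x y : Fin 5, pairA y x = pairA x y := by decide
  rw [hs (F.lab q.2) (F.lab q.1), hs (F.lab (q.1 ∪ q.2)ᶜ) (F.lab q.1), hs (F.lab (q.1 ∪ q.2)ᶜ) (F.lab q.2)]
  ring

/-- `6·NBB` symmetrised. [this work] -/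
theorem six_NBB_eq : 6 * F.NBB = ∑ q ∈ parts α,
    2 * (pairB (F.lab q.1) (F.lab q.2) + pairB (F.lab q.1) (F.lab (q.1 ∪ q.2)ᶜ) + pairB (F.lab q.2) (F.lab (q.1 ∪ q.2)ᶜ)) := by
  unfold NBB
  rw [sum_parts_symm6 (fun x y _ => pairB x y) F]
  refine sum_congr rfl fun q _ => ?_
  have hs : ∀ x y : Fin 5, pairB y x = pairB x y := by decide
  rw [hs (F.lab q.2) (F.lab q.1), hs (F.lab (q.1 ∪ q.2)ᶜ) (F.lab q.1), hs (F.lab (q.1 ∪ q.2)ᶜ) (F.lab q.2)]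
  ring

/-- **`3·SA − Ntri = 6·(NAA − NV)`** — Lemma A (`Ntri ≤ 3·SA`, kernel spectators pay for the rainbows) is EXACTLY the counting inequality
`#{(P¹,P²,P³) : P¹ ∈ V₁, P² ∈ V₂, P³ ∈ V₃} ≤ #{(P¹,P²,P³) : P¹, P² ∈ A}`. [this work] -/
theorem three_SA_sub_Ntri : 3 * F.SA - F.Ntri = 6 * (F.NAA - F.NV) := by
  have hA : 3 * F.SA = ∑ q ∈ parts α,
      ((if F.lab q.1 = 4 then (1 : ℤ) else 0) * kk (F.lab q.2) (F.lab (q.1 ∪ q.2)ᶜ)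
        + (if F.lab q.2 = 4 then (1 : ℤ) else 0) * kk (F.lab q.1) (F.lab (q.1 ∪ q.2)ᶜ)
        + (if F.lab (q.1 ∪ q.2)ᶜ = 4 then (1 : ℤ) else 0) * kk (F.lab q.1) (F.lab q.2)) := by
    unfold SA
    rw [← F.sum_spec_eq]
  have hV : 6 * F.NV = ∑ q ∈ parts α, _ := sum_parts_symm6 vind F
  rw [mul_sub, F.six_NAA_eq, hV, hA]
  unfold Ntri
  rw [← sum_sub_distrib, ← sum_sub_distrib]
  exact sum_congr rfl fun q _ => specA_pointwise _ _ _

/-- **`3·SB − Ntri = 6·(NBB − ND)`** — Lemma B (`Ntri ≤ 3·SB`) is exactly `#{Pⁱ ∈ B ∪ C_i ∀i} ≤ #{P¹, P² ∈ B}`. [this work] -/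
theorem three_SB_sub_Ntri : 3 * F.SB - F.Ntri = 6 * (F.NBB - F.ND) := by
  have hB : 3 * F.SB = ∑ q ∈ parts α,
      ((if F.lab q.1 = 0 then (1 : ℤ) else 0) * kk (F.lab q.2) (F.lab (q.1 ∪ q.2)ᶜ)
        + (if F.lab q.2 = 0 then (1 : ℤ) else 0) * kk (F.lab q.1) (F.lab (q.1 ∪ q.2)ᶜ)
        + (if F.lab (q.1 ∪ q.2)ᶜ = 0 then (1 : ℤ) else 0) * kk (F.lab q.1) (F.lab q.2)) := by
    unfold SB
    rw [← F.sum_spec_eq]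
  have hD : 6 * F.ND = ∑ q ∈ parts α, _ := sum_parts_symm6 dind F
  rw [mul_sub, F.six_NBB_eq, hD, hB]
  unfold Ntri
  rw [← sum_sub_distrib, ← sum_sub_distrib]
  exact sum_congr rfl fun q _ => specB_pointwise _ _ _

/-- **`ZH = 6·(NAA + NBB + N123 − NV − ND)`**: the `H`-row partition functional counts 'two blocks in the core' plus 'two blocks in the bottom'
plus rainbows, minus 'one block in each `V_i`' minus 'one block in each `B ∪ C_i`'. [this work] -/
theorem ZH_eq_counts : F.ZH = 6 * (F.NAA + F.NBB + F.N123 - F.NV - F.ND) := by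
  have h1 := F.ZH_eq_SA_SB
  have h2 := F.three_SA_sub_Ntri
  have h3 := F.three_SB_sub_Ntri
  have h4 := F.Ntri_eq_six_mul_N123
  linarith

/-- Lemma A in counting form. [this work] -/
theorem lemmaA_iff : F.Ntri ≤ 3 * F.SA ↔ F.NV ≤ F.NAA := by
  have h := F.three_SA_sub_Ntri
  constructor <;> intro hh <;> linarith

/-- Lemma B in counting form. [this work] -/
theorem lemmaB_iff : F.Ntri ≤ 3 * F.SB ↔ F.ND ≤ F.NBB := by
  have h := F.three_SB_sub_Ntri
  constructor <;> intro hh <;> linarith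

end Sunflower

/-- **`PurePayer` in counting form**: for every sunflower, `NV ≤ NAA` or `ND ≤ NBB`. [this work] -/
theorem purePayer_iff_counts :
    PurePayer ↔ ∀ (α : Type) [Fintype α] [DecidableEq α] (F : Sunflower α), F.NV ≤ F.NAA ∨ F.ND ≤ F.NBB := by
  constructor
  · intro h α _ _ F
    have hP := h α F
    rcases le_total F.SA F.SB with hle | hle
    · rw [max_eq_right hle] at hP
      exact Or.inr (F.lemmaB_iff.1 hP)
    · rw [max_eq_left hle] at hP
      exact Or.inl (F.lemmaA_iff.1 hP)
  · intro h α _ _ F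
    rcases h α F with hA | hB
    · exact le_trans (F.lemmaA_iff.2 hA) (by have := le_max_left F.SA F.SB; linarith)
    · exact le_trans (F.lemmaB_iff.2 hB) (by have := le_max_right F.SA F.SB; linarith)

/-- **`PartitionLemmaH` in counting form**: `NV + ND ≤ NAA + NBB + N123` for every sunflower. [this work] -/
theorem partitionLemmaH_iff_counts :
    PartitionLemmaH ↔ ∀ (α : Type) [Fintype α] [DecidableEq α] (F : Sunflower α), F.NV + F.ND ≤ F.NAA + F.NBB + F.N123 := by
  constructor
  · intro h α _ _ F
    have h1 := h α F
    rw [F.ZH_eq_counts] at h1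
    linarith
  · intro h α _ _ F
    rw [F.ZH_eq_counts]
    have h1 := h α F
    linarith

end Summit.CriticalPhenomena.PercolationContinuityZ3.Theorems.SunflowerPartition
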